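import Summits.RiemannHypothesis.RiemannHypothesis.Theorems.SemilocalDeletionSchurFloor
import HarnessLib

/-!
# Signed CHAINS of blocks attain the Schur floor: the multi-deletion cliff is a sandwich too

Sequel to `SemilocalDeletionDipole.lean` (one prime: antisymmetric dipoles attain the floor `−log p/√p`) and
`SemilocalDeletionSchurFloor.lean` (several primes `D`: `Re Q_{S∖D} ≥ Re Q_S − ρ‖g‖₂²` for every Schur weight of the orbit
graph of the lags `log p`, `p ∈ D`, on the window).  Here the matching UPPER half: for a comb of translates of one block,
`g = Σ_i a_i h(· − x_i)`, `h ∈ C(δ)`, whose node configuration is RESOLVED at every deleted lag (each pair of nodes sits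
either exactly at distance `log p` or more than `2δ` off it),

* §1 `k_g(t) = Σ_{i,j} a_i conj(a_j) k_h(t − (x_i − x_j))`, hence `k_g(L) = (Σ_{x_i − x_j = L} a_i conj a_j)·‖h‖₂²` at a resolved
  lag and `‖g‖₂² = (Σ|a_i|²)‖h‖₂²` for separated nodes;
* §2 **`weilSemilocalQuadratic_sdiff_comb`**: `Q_{S∖D}(g) = Q_S(g) + (Σ_{p∈D} (log p/√p)(E_p + conj E_p))·‖h‖₂²` EXACTLY,
  `E_p = Σ_{x_i − x_j = log p} a_i conj a_j` (real coefficients: `+ 2(Σ_p w_p E_p)‖h‖₂²`);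
* §3 **`semilocalGroundEnergy_sdiff_add_mul_le`**: if the real coefficient vector `b` satisfies the signed Perron relation
  `2Σ_p w_p E_p(b) = −ρ Σ b_i²` then `(λ_min(S∖D; c; P) + ρ)·‖g_b‖₂² ≤ Re Q_S(g_b)` — with `b` the Perron vector of the orbit
  graph signed along its bipartition (every lag step flips the parity of the number of steps), `ρ` = spectral radius, this is
  the ceiling matching the Schur floor: `0 ≤ Δ_D ≤ D_chain`, the multi-prime version of the dipole sandwich.

Numerics (rh-explicit, lineage E, BLIND under handoff-idea-1's PRED-CLIFF19-ORBIT PART O): the orbit-graph floor is never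
violated (16/16) and is approached to 0.004–0.03 by the free-odd sector on roomy sets.  Nothing here bears on RH.
-/

set_option linter.dupNamespace false

noncomputable section

open Complex Filter Set MeasureTheory
open scoped Real Topology ComplexConjugate

namespace Summit.RiemannHypothesis.RiemannHypothesis.Theorems.SemilocalDeletionChain

open Literature.NumberTheory.LFunctions
open Summit.RiemannHypothesis.RiemannHypothesis.Theorems.SemilocalDeletionCliff
open Summit.RiemannHypothesis.RiemannHypothesis.Theorems.SemilocalDeletionSchurFloor
open Summit.RiemannHypothesis.RiemannHypothesis.Theorems.HandoffSemilocalEnergy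

variable {ι : Type*} {h : ℝ → ℂ} {δ c : ℝ}

/-! ## §1  Combs of translates of one block: autocorrelation -/

/-- The comb `g = Σ_{i∈s} a_i · h(· − x_i)`. (Notation only inside proofs: we always write the sum explicitly.) -/
theorem isWeilTest_comb (hh : IsWeilTest h) (s : Finset ι) (a : ι → ℂ) (x : ι → ℝ) :
    IsWeilTest (fun t ↦ ∑ i ∈ s, a i * h (t - x i)) := by
  classical
  induction s using Finset.induction_on with
  | empty => simp only [Finset.sum_empty]; exact ⟨contDiff_const, HasCompactSupport.zero⟩
  | insert j s hj ih =>
    have h1 : IsWeilTest (fun t ↦ a j * h (t - x j)) := (hh.weilTranslate (x j)).const_mul (a j)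
    convert h1.add ih using 1
    funext t
    simp [Finset.sum_insert hj]

/-- Support of the comb: if every node lies in `[−(c − δ), c − δ]` and `h ∈ C(δ)` then the comb lies in `C(c)`. -/
theorem tsupport_comb_subset (hsupp : tsupport h ⊆ Icc (-δ) δ) (s : Finset ι) (a : ι → ℂ) {x : ι → ℝ}
    (hx : ∀ i ∈ s, x i ∈ Icc (-(c - δ)) (c - δ)) :
    tsupport (fun t ↦ ∑ i ∈ s, a i * h (t - x i)) ⊆ Icc (-c) c := by
  refine (isClosed_Icc.closure_subset_iff).2 fun t ht ↦ ?_
  rw [Function.mem_support] at ht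
  obtain ⟨i, hi, hne⟩ := Finset.exists_ne_zero_of_sum_ne_zero ht
  have hhi : h (t - x i) ≠ 0 := fun h0 ↦ hne (by rw [h0, mul_zero])
  have h1 := hsupp (subset_tsupport _ (Function.mem_support.2 hhi))
  have h2 := hx i hi
  rw [mem_Icc] at h1 h2 ⊢
  constructor <;> linarith [h1.1, h1.2, h2.1, h2.2]

/-- The autocorrelation of the comb, as a double sum of shifted autocorrelations of the block:
`k_g(t) = Σ_i Σ_j a_i conj(a_j) · k_h(t − (x_i − x_j))`. -/
theorem weilConv_weilReflect_comb (hh : IsWeilTest h) (s : Finset ι) (a : ι → ℂ) (x : ι → ℝ) (t : ℝ) :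
    weilConv (fun t ↦ ∑ i ∈ s, a i * h (t - x i)) (weilReflect fun t ↦ ∑ i ∈ s, a i * h (t - x i)) t =
      ∑ i ∈ s, ∑ j ∈ s, a i * conj (a j) * weilConv h (weilReflect h) (t - (x i - x j)) := by
  rw [weilConv_apply]
  -- integrability of each product term
  have hint : ∀ i j : ι, Integrable fun u : ℝ ↦ a i * h (u - x i) * (conj (a j) * conj (h (-(t - u) - x j))) := by
    intro i j
    have hc : Continuous fun u : ℝ ↦ a i * h (u - x i) * (conj (a j) * conj (h (-(t - u) - x j))) := by
      have h1 : Continuous fun u : ℝ ↦ h (u - x i) := hh.1.continuous.comp (continuous_id.sub continuous_const)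
      have h2 : Continuous fun u : ℝ ↦ conj (h (-(t - u) - x j)) :=
        Complex.continuous_conj.comp (hh.1.continuous.comp ((continuous_const.sub continuous_id).neg.sub continuous_const))
      exact (continuous_const.mul h1).mul (continuous_const.mul h2)
    refine hc.integrable_of_hasCompactSupport ?_
    have hs1 : HasCompactSupport fun u : ℝ ↦ h (u - x i) := (hh.weilTranslate (x i)).2
    exact ((hs1.mul_left).mul_right)
  have e : ∀ u : ℝ, (∑ i ∈ s, a i * h (u - x i)) * weilReflect (fun t ↦ ∑ i ∈ s, a i * h (t - x i)) (t - u) =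
      ∑ i ∈ s, ∑ j ∈ s, a i * h (u - x i) * (conj (a j) * conj (h (-(t - u) - x j))) := by
    intro u
    simp only [weilReflect, map_sum, map_mul, Finset.sum_mul, Finset.mul_sum]
    exact Finset.sum_comm
  simp_rw [e]
  rw [integral_finsetSum _ fun i _ ↦ integrable_finsetSum _ fun j _ ↦ hint i j]
  refine Finset.sum_congr rfl fun i _ ↦ ?_
  rw [integral_finsetSum _ fun j _ ↦ hint i j]
  refine Finset.sum_congr rfl fun j _ ↦ ?_
  rw [weilConv_apply]
  have key := integral_sub_right_eq_self (μ := (volume : Measure ℝ))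
    (fun v : ℝ ↦ h v * weilReflect h (t - (x i - x j) - v)) (x i)
  rw [← key, ← integral_const_mul]
  congr 1 with u
  simp only [weilReflect]
  rw [show -(t - (x i - x j) - (u - x i)) = -(t - u) - x j by ring]
  ring

/-- **Resolved combs.** If `h ∈ C(δ)` and at the lag `L` every pair of nodes is either EXACTLY at distance `L`
(`x_i − x_j = L`) or more than `2δ` away from it, then `k_g(L) = (Σ_{x_i − x_j = L} a_i conj a_j)·‖h‖₂²`. -/
theorem weilConv_weilReflect_comb_of_resolved (hh : IsWeilTest h) (hsupp : tsupport h ⊆ Icc (-δ) δ) (hδ : 0 ≤ δ)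
    (s : Finset ι) (a : ι → ℂ) (x : ι → ℝ) (L : ℝ)
    (hres : ∀ i ∈ s, ∀ j ∈ s, x i - x j = L ∨ 2 * δ < |L - (x i - x j)|) :
    weilConv (fun t ↦ ∑ i ∈ s, a i * h (t - x i)) (weilReflect fun t ↦ ∑ i ∈ s, a i * h (t - x i)) L =
      (∑ p ∈ (s ×ˢ s).filter (fun p ↦ x p.1 - x p.2 = L), a p.1 * conj (a p.2)) *
        (((∫ u : ℝ, ‖h u‖ ^ 2 : ℝ)) : ℂ) := by
  rw [weilConv_weilReflect_comb hh, ← Finset.sum_product', Finset.sum_filter, Finset.sum_mul]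
  refine Finset.sum_congr rfl fun p hp ↦ ?_
  rw [Finset.mem_product] at hp
  rcases hres p.1 hp.1 p.2 hp.2 with heq | hfar
  · rw [if_pos heq, show L - (x p.1 - x p.2) = 0 by linarith [heq], weilConv_weilReflect_apply_zero]
  · have hne : ¬ x p.1 - x p.2 = L := by
      intro heq; rw [heq, sub_self, abs_zero] at hfar; linarith
    rw [if_neg hne, weilConv_weilReflect_eq_zero_of_lt hh hsupp hfar, mul_zero, zero_mul]

/-- **Norm of a separated comb**: if distinct nodes are more than `2δ` apart, `‖g‖₂² = (Σ_i |a_i|²)·‖h‖₂²`. -/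
theorem integral_norm_sq_comb (hh : IsWeilTest h) (hsupp : tsupport h ⊆ Icc (-δ) δ) (hδ : 0 ≤ δ) (s : Finset ι)
    (a : ι → ℂ) (x : ι → ℝ) (hsep : ∀ i ∈ s, ∀ j ∈ s, i ≠ j → 2 * δ < |x i - x j|) :
    ∫ u : ℝ, ‖∑ i ∈ s, a i * h (u - x i)‖ ^ 2 = (∑ i ∈ s, ‖a i‖ ^ 2) * ∫ u : ℝ, ‖h u‖ ^ 2 := by
  classical
  have hres : ∀ i ∈ s, ∀ j ∈ s, x i - x j = 0 ∨ 2 * δ < |0 - (x i - x j)| := by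
    intro i hi j hj
    by_cases hij : i = j
    · left; rw [hij, sub_self]
    · right; rw [zero_sub, abs_neg]; exact hsep i hi j hj hij
  have h0 := weilConv_weilReflect_comb_of_resolved hh hsupp hδ s a x 0 hres
  rw [weilConv_weilReflect_apply_zero] at h0
  have hdiag : (∑ p ∈ (s ×ˢ s).filter (fun p ↦ x p.1 - x p.2 = 0), a p.1 * conj (a p.2)) =
      ((∑ i ∈ s, ‖a i‖ ^ 2 : ℝ) : ℂ) := by
    have hf : (s ×ˢ s).filter (fun p : ι × ι ↦ x p.1 - x p.2 = 0) = (s ×ˢ s).filter (fun p ↦ p.1 = p.2) := by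
      ext p
      simp only [Finset.mem_filter, Finset.mem_product, and_congr_right_iff, sub_eq_zero]
      intro hp
      constructor
      · intro hx; by_contra hne
        have := hsep p.1 hp.1 p.2 hp.2 hne
        rw [hx, sub_self, abs_zero] at this
        linarith
      · intro he; rw [he]
    rw [hf, Finset.sum_filter, Finset.sum_product]
    push_cast
    refine Finset.sum_congr rfl fun i hi ↦ ?_
    rw [Finset.sum_ite_eq s i, if_pos hi, Complex.mul_conj']
  rw [hdiag, ← Complex.ofReal_mul] at h0
  exact_mod_cast h0


/-! ## §2  Deleting a set of primes on a resolved comb: the exact cost is a lag sum -/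

variable {S : Finset ℕ}

/-- **Multi-deletion on a comb, exactly.** Let `D ⊆ S` be primes with `c < log p`, `h ∈ C(δ)` (`0 ≤ δ`), nodes
`x_i ∈ [−(c − δ), c − δ]` (so the comb `g = Σ a_i h(· − x_i)` lies in `C(c)`), and suppose the configuration is RESOLVED at every
deleted lag: each pair of nodes is either exactly at distance `log p` or more than `2δ` off it.  Then
`Q_{S∖D}(g) = Q_S(g) + (Σ_{p∈D} (log p/√p)·(E_p + conj E_p))·‖h‖₂²`, `E_p = Σ_{x_i − x_j = log p} a_i conj a_j`. -/
theorem weilSemilocalQuadratic_sdiff_comb (hh : IsWeilTest h) (hsupp : tsupport h ⊆ Icc (-δ) δ) (hδ : 0 ≤ δ)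
    (s : Finset ι) (a : ι → ℂ) {x : ι → ℝ} (hx : ∀ i ∈ s, x i ∈ Icc (-(c - δ)) (c - δ))
    (D : Finset ℕ) (hDS : D ⊆ S) (hprime : ∀ p ∈ D, p.Prime) (hlog : ∀ p ∈ D, c < Real.log p)
    (hres : ∀ p ∈ D, ∀ i ∈ s, ∀ j ∈ s, x i - x j = Real.log p ∨ 2 * δ < |Real.log p - (x i - x j)|) :
    weilSemilocalQuadratic (S \ D) (fun t ↦ ∑ i ∈ s, a i * h (t - x i)) =
      weilSemilocalQuadratic S (fun t ↦ ∑ i ∈ s, a i * h (t - x i)) +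
        (∑ p ∈ D, ((Real.log p / Real.sqrt p : ℝ) : ℂ) *
          ((∑ q ∈ (s ×ˢ s).filter (fun q ↦ x q.1 - x q.2 = Real.log p), a q.1 * conj (a q.2)) +
            conj (∑ q ∈ (s ×ˢ s).filter (fun q ↦ x q.1 - x q.2 = Real.log p), a q.1 * conj (a q.2)))) *
          (((∫ u : ℝ, ‖h u‖ ^ 2 : ℝ)) : ℂ) := by
  have hg := isWeilTest_comb hh s a x
  have hgs := tsupport_comb_subset hsupp s a hx
  rw [weilSemilocalQuadratic_sdiff_eq hg hgs D hDS hprime hlog, Finset.sum_mul]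
  congr 1
  refine Finset.sum_congr rfl fun p hp ↦ ?_
  have hk := weilConv_weilReflect_comb_of_resolved hh hsupp hδ s a x (Real.log p) (hres p hp)
  have hk' : weilConv (fun t ↦ ∑ i ∈ s, a i * h (t - x i)) (weilReflect fun t ↦ ∑ i ∈ s, a i * h (t - x i))
      (-Real.log p) = conj ((∑ q ∈ (s ×ˢ s).filter (fun q ↦ x q.1 - x q.2 = Real.log p), a q.1 * conj (a q.2))) *
        (((∫ u : ℝ, ‖h u‖ ^ 2 : ℝ)) : ℂ) := by
    have := congrArg conj (conj_weilConv_weilReflect_neg (fun t ↦ ∑ i ∈ s, a i * h (t - x i)) (Real.log p))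
    rw [Complex.conj_conj] at this
    rw [this, hk, map_mul, Complex.conj_ofReal]
  rw [hk, hk']
  ring

/-- Real coefficients: the lag sums are real and `E_p + conj E_p = 2E_p`, so
`Re Q_{S∖D}(g) = Re Q_S(g) + 2·(Σ_{p∈D} (log p/√p)·Σ_{x_i − x_j = log p} b_i b_j)·‖h‖₂²`. -/
theorem re_weilSemilocalQuadratic_sdiff_comb_real (hh : IsWeilTest h) (hsupp : tsupport h ⊆ Icc (-δ) δ) (hδ : 0 ≤ δ)
    (s : Finset ι) (b : ι → ℝ) {x : ι → ℝ} (hx : ∀ i ∈ s, x i ∈ Icc (-(c - δ)) (c - δ))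
    (D : Finset ℕ) (hDS : D ⊆ S) (hprime : ∀ p ∈ D, p.Prime) (hlog : ∀ p ∈ D, c < Real.log p)
    (hres : ∀ p ∈ D, ∀ i ∈ s, ∀ j ∈ s, x i - x j = Real.log p ∨ 2 * δ < |Real.log p - (x i - x j)|) :
    (weilSemilocalQuadratic (S \ D) (fun t ↦ ∑ i ∈ s, (b i : ℂ) * h (t - x i))).re =
      (weilSemilocalQuadratic S (fun t ↦ ∑ i ∈ s, (b i : ℂ) * h (t - x i))).re +
        2 * (∑ p ∈ D, Real.log p / Real.sqrt p *
          ∑ q ∈ (s ×ˢ s).filter (fun q ↦ x q.1 - x q.2 = Real.log p), b q.1 * b q.2) * ∫ u : ℝ, ‖h u‖ ^ 2 := by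
  rw [weilSemilocalQuadratic_sdiff_comb hh hsupp hδ s (fun i ↦ (b i : ℂ)) hx D hDS hprime hlog hres]
  have hE : ∀ p : ℕ, (∑ q ∈ (s ×ˢ s).filter (fun q ↦ x q.1 - x q.2 = Real.log p), ((b q.1 : ℝ) : ℂ) * conj ((b q.2 : ℝ) : ℂ)) =
      ((∑ q ∈ (s ×ˢ s).filter (fun q ↦ x q.1 - x q.2 = Real.log p), b q.1 * b q.2 : ℝ) : ℂ) := by
    intro p
    push_cast
    refine Finset.sum_congr rfl fun q _ ↦ ?_
    rw [Complex.conj_ofReal]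
  simp_rw [hE, Complex.conj_ofReal]
  have e2 : ∀ p : ℕ, ((Real.log p / Real.sqrt p : ℝ) : ℂ) *
      (((∑ q ∈ (s ×ˢ s).filter (fun q ↦ x q.1 - x q.2 = Real.log p), b q.1 * b q.2 : ℝ) : ℂ) +
        ((∑ q ∈ (s ×ˢ s).filter (fun q ↦ x q.1 - x q.2 = Real.log p), b q.1 * b q.2 : ℝ) : ℂ)) =
      ((2 * (Real.log p / Real.sqrt p * ∑ q ∈ (s ×ˢ s).filter (fun q ↦ x q.1 - x q.2 = Real.log p), b q.1 * b q.2) : ℝ) : ℂ) := by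
    intro p; push_cast; ring
  simp_rw [e2]
  rw [← Complex.ofReal_sum, ← Complex.ofReal_mul, Complex.add_re, Complex.ofReal_re, ← Finset.mul_sum]

/-! ## §3  The ceiling: signed Perron chains attain the Schur floor -/

variable {P : (ℝ → ℂ) → Prop} {ρ : ℝ}

/-- **CEILING for multi-deletions (chain test).** With the data of `re_weilSemilocalQuadratic_sdiff_comb_real`, nodes pairwise
more than `2δ` apart, and real coefficients `b` satisfying the (signed Perron) relation
`2·Σ_{p∈D} (log p/√p)·Σ_{x_i − x_j = log p} b_i b_j = −ρ·Σ_i b_i²`, the comb `g_b` (and its positive multiples) lying in the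
constraint `P`: `(λ_min(S∖D; c; P) + ρ)·‖g_b‖₂² ≤ Re Q_S(g_b)` with `‖g_b‖₂² = (Σ b_i²)‖h‖₂²`.  With `ρ` the spectral radius of the
orbit graph and `b` its Perron vector signed by the bipartition, this is the upper half of the multi-deletion sandwich whose
lower half is `SemilocalDeletionSchurFloor.semilocalGroundEnergy_sdiff_ge_of_schur`. -/
theorem semilocalGroundEnergy_sdiff_add_mul_le (hh : IsWeilTest h) (hsupp : tsupport h ⊆ Icc (-δ) δ) (hδ : 0 ≤ δ)
    (s : Finset ι) (b : ι → ℝ) {x : ι → ℝ} (hx : ∀ i ∈ s, x i ∈ Icc (-(c - δ)) (c - δ))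
    (hsep : ∀ i ∈ s, ∀ j ∈ s, i ≠ j → 2 * δ < |x i - x j|)
    (D : Finset ℕ) (hDS : D ⊆ S) (hprime : ∀ p ∈ D, p.Prime) (hlog : ∀ p ∈ D, c < Real.log p)
    (hres : ∀ p ∈ D, ∀ i ∈ s, ∀ j ∈ s, x i - x j = Real.log p ∨ 2 * δ < |Real.log p - (x i - x j)|)
    (hPerron : 2 * ∑ p ∈ D, Real.log p / Real.sqrt p *
        ∑ q ∈ (s ×ˢ s).filter (fun q ↦ x q.1 - x q.2 = Real.log p), b q.1 * b q.2 = -ρ * ∑ i ∈ s, b i ^ 2)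
    (hP : ∀ r : ℝ, 0 < r → P fun t ↦ (r : ℂ) * ∑ i ∈ s, (b i : ℂ) * h (t - x i)) :
    (semilocalGroundEnergy (S \ D) P c + ρ) * ((∑ i ∈ s, b i ^ 2) * ∫ u : ℝ, ‖h u‖ ^ 2) ≤
      (weilSemilocalQuadratic S (fun t ↦ ∑ i ∈ s, (b i : ℂ) * h (t - x i))).re := by
  have hg := isWeilTest_comb hh s (fun i ↦ (b i : ℂ)) x
  have hgs := tsupport_comb_subset hsupp s (fun i ↦ (b i : ℂ)) hx
  have hR := semilocalGroundEnergy_mul_le_re (S := S \ D) (P := P) hg hgs hP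
  have hN := integral_norm_sq_comb hh hsupp hδ s (fun i ↦ (b i : ℂ)) x hsep
  simp only [Complex.norm_real, Real.norm_eq_abs, sq_abs] at hN
  rw [hN, re_weilSemilocalQuadratic_sdiff_comb_real hh hsupp hδ s b hx D hDS hprime hlog hres, hPerron] at hR
  have e : (semilocalGroundEnergy (S \ D) P c + ρ) * ((∑ i ∈ s, b i ^ 2) * ∫ u : ℝ, ‖h u‖ ^ 2) =
      semilocalGroundEnergy (S \ D) P c * ((∑ i ∈ s, b i ^ 2) * ∫ u : ℝ, ‖h u‖ ^ 2) -
        (-ρ * ∑ i ∈ s, b i ^ 2) * ∫ u : ℝ, ‖h u‖ ^ 2 := by ring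
  rw [e]
  linarith

end Summit.RiemannHypothesis.RiemannHypothesis.Theorems.SemilocalDeletionChain

end
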